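import Mathlib
import Summits.NavierStokesRegularity.NavierStokesRegularity.Theorems.EulerZoomLiouvillePowerGaugeEulerLiouvilleNeedleLogisticLaw

/-!
# THEOREM L (continued) — ANGULAR-MOMENTUM LEDGER, PRESSURE-FREE ORBITS, THE TURNING LAW
# (nsreg-p2 g34 ROUND-44 §1, plate t46-M: (L3), (L4), (L5))

Width piece for crux `EulerZoomLiouville.PowerGaugeEulerLiouville` (stmt-NavierStokesRegularity-19832), by name under LEAD 19832
(ns-typeII-p2 g13); seat ns-ezl-w2 g4, `--supports stmt-NavierStokesRegularity-19832 --as helper`.  Texts = nsreg-p2's Sketch44 Props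
`NsregP2.R44.AngularMomentumLedger`, `…PressureFreeOrbit`, `…TurningLaw` binder-for-binder (`E3` spelled out).

* (L3) **`fderiv_angularMomentum_transport`** — for fixed `a b`, the `(a,b)` component `ω_{ab}(y) = ⟪y,a⟫⟪U y,b⟫ − ⟪y,b⟫⟪U y,a⟫` of
  `y × U y` obeys `(W·∇)ω_{ab} = (2γ−1)ω_{ab} − (⟪y,a⟫⟪∇P,b⟫ − ⟪y,b⟫⟪∇P,a⟫)` (CIV's axisymmetric circulation law `rU_θ e^{(1−2γ)τ} = const`
  in vector form, no symmetry, WITH the pressure torque);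
* (L4) **`pressureFreeOrbit_explicit`** — if `Y′ = −(γY + Z)` and `Z′ = (1−γ)Z` on `[0, σ₁]` then `Z σ = e^{(1−γ)σ}Z 0` and
  `Y σ = e^{−γσ}(Y 0 + Z 0) − e^{(1−γ)σ}Z 0` (free flight `D_t u = 0` in similarity coordinates; the label turns BALLISTIC);
* (L5) **`turningLaw`** — scalar calculus: the pressure-free height `a(σ) = a₀e^{−γσ}(1 − L₀ + L₀e^σ)` (`0 < L₀ < γ < 1`, `a₀ > 0`) is
  minimal exactly where the logistic ratio `L = L₀e^σ/(1−L₀+L₀e^σ)` crosses `L = γ`, at `σ* = log(γ(1−L₀)/((1−γ)L₀))`, with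
  `a(σ*) = a₀(L₀/γ)^γ((1−L₀)/(1−γ))^{1−γ}` («the dive», exact);
* `angularMomentumLedger`, `pressureFreeOrbit`, `turningLaw_text` — the Sketch44 texts.

HONEST FRAMING: calculus identities / linear ODE bookkeeping for HYPOTHETICAL self-similar Euler profiles (MODEL lattice of the crux class);
nothing here proves the crux E (19832 OPEN), any door Target, or Navier–Stokes regularity.
[cite: ConstantinIgnatovaVicol2026Putative, §3.1.1 eq. (3.3), §4 (p. 15, circulation law)]
-/

noncomputable section

open Set Filter Topology Metric Function InnerProductSpace
open scoped RealInnerProductSpace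

set_option linter.dupNamespace false

namespace Summit.NavierStokesRegularity.NavierStokesRegularity.Theorems.PowerGaugeEulerLiouville.Logistic

open Literature.Analysis Literature.Analysis.FluidPDE
open Summit.NavierStokesRegularity.NavierStokesRegularity.Theorems.PowerGaugeEulerLiouville

variable {γ : ℝ} {U : EuclideanSpace ℝ (Fin 3) → EuclideanSpace ℝ (Fin 3)} {P : EuclideanSpace ℝ (Fin 3) → ℝ}

/-! ### (L3) The angular-momentum ledger -/

/-- **(L3) ANGULAR-MOMENTUM LEDGER** (exact, class-free): `(W·∇)ω_{ab} = (2γ−1)ω_{ab} − (⟪y,a⟫⟪∇P,b⟫ − ⟪y,b⟫⟪∇P,a⟫)` for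
`ω_{ab}(y) = ⟪y,a⟫⟪U y,b⟫ − ⟪y,b⟫⟪U y,a⟫`. [cite: ConstantinIgnatovaVicol2026Putative, §3.1.1 eq. (3.3)] -/
theorem fderiv_angularMomentum_transport (hprof : IsSelfSimilarEulerProfile γ 0 U P) (a b y : EuclideanSpace ℝ (Fin 3)) :
    fderiv ℝ (fun x : EuclideanSpace ℝ (Fin 3) => ⟪x, a⟫ * ⟪U x, b⟫ - ⟪x, b⟫ * ⟪U x, a⟫) y (selfSimilarTransport γ 0 U y) =
      (2 * γ - 1) * (⟪y, a⟫ * ⟪U y, b⟫ - ⟪y, b⟫ * ⟪U y, a⟫)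
        - (⟪y, a⟫ * ⟪gradient P y, b⟫ - ⟪y, b⟫ * ⟪gradient P y, a⟫) := by
  have h1 := (hasFDerivAt_inner_id_const y a).mul (hasFDerivAt_inner_velocity_const hprof y b)
  have h2 := (hasFDerivAt_inner_id_const y b).mul (hasFDerivAt_inner_velocity_const hprof y a)
  have hf : HasFDerivAt (fun x : EuclideanSpace ℝ (Fin 3) => ⟪x, a⟫ * ⟪U x, b⟫ - ⟪x, b⟫ * ⟪U x, a⟫)
      ((⟪y, a⟫ • (innerSL ℝ b).comp (fderiv ℝ U y) + ⟪U y, b⟫ • innerSL ℝ a) -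
        (⟪y, b⟫ • (innerSL ℝ a).comp (fderiv ℝ U y) + ⟪U y, a⟫ • innerSL ℝ b)) y := by
    refine (h1.sub h2).congr_of_eventuallyEq (Filter.Eventually.of_forall fun x => ?_)
    simp only [Pi.sub_apply, Pi.mul_apply]
  rw [hf.fderiv]
  simp only [_root_.sub_apply, _root_.add_apply, FunLike.coe_smul, Pi.smul_apply, ContinuousLinearMap.comp_apply,
    innerSL_apply_apply, smul_eq_mul]
  rw [real_inner_comm (fderiv ℝ U y (selfSimilarTransport γ 0 U y)) b,
    real_inner_comm (fderiv ℝ U y (selfSimilarTransport γ 0 U y)) a, inner_fderiv_velocity_transport hprof y b,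
    inner_fderiv_velocity_transport hprof y a, real_inner_comm (selfSimilarTransport γ 0 U y) a,
    real_inner_comm (selfSimilarTransport γ 0 U y) b, inner_selfSimilarTransport_left, inner_selfSimilarTransport_left]
  ring

/-! ### (L4) Pressure-free orbits are explicit -/

/-- **(L4) PRESSURE-FREE ORBITS ARE EXPLICIT** (linear ODE).  If `Y′ = −(γY + Z)` and `Z′ = (1−γ)Z` on `[0, σ₁]`, then for
`σ ∈ [0, σ₁]`: `Z σ = e^{(1−γ)σ}Z 0` and `Y σ = e^{−γσ}(Y 0 + Z 0) − e^{(1−γ)σ}Z 0` (integrating factors `e^{−(1−γ)σ}` and `e^{γσ}`).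
[folklore] -/
theorem pressureFreeOrbit_explicit {γ σ₁ : ℝ} {Y Z : ℝ → EuclideanSpace ℝ (Fin 3)} (hσ₁ : 0 < σ₁)
    (hY : ∀ σ ∈ Icc (0 : ℝ) σ₁, HasDerivAt Y (-(γ • Y σ + Z σ)) σ)
    (hZ : ∀ σ ∈ Icc (0 : ℝ) σ₁, HasDerivAt Z ((1 - γ) • Z σ) σ) :
    ∀ σ ∈ Icc (0 : ℝ) σ₁,
      Z σ = Real.exp ((1 - γ) * σ) • Z 0 ∧
        Y σ = Real.exp (-γ * σ) • (Y 0 + Z 0) - Real.exp ((1 - γ) * σ) • Z 0 := by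
  have _ := hσ₁
  -- step 1: `g σ = e^{−(1−γ)σ} Z σ` is constant
  set g : ℝ → EuclideanSpace ℝ (Fin 3) := fun σ => Real.exp (-(1 - γ) * σ) • Z σ with hg
  have hg' : ∀ σ ∈ Icc (0 : ℝ) σ₁, HasDerivAt g 0 σ := by
    intro σ hσ
    have hexp : HasDerivAt (fun r => Real.exp (-(1 - γ) * r)) (Real.exp (-(1 - γ) * σ) * (-(1 - γ))) σ := by
      simpa using ((hasDerivAt_id σ).const_mul (-(1 - γ))).exp
    have h := hexp.smul (hZ σ hσ)
    refine h.congr_deriv ?_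
    rw [smul_smul]
    module
  have hgc : ContinuousOn g (Icc 0 σ₁) := fun σ hσ => (hg' σ hσ).continuousAt.continuousWithinAt
  have hgconst := constant_of_has_deriv_right_zero hgc (fun σ hσ => (hg' σ (Ico_subset_Icc_self hσ)).hasDerivWithinAt)
  have hZform : ∀ σ ∈ Icc (0 : ℝ) σ₁, Z σ = Real.exp ((1 - γ) * σ) • Z 0 := by
    intro σ hσ
    have e := hgconst σ hσ
    simp only [hg, mul_zero, Real.exp_zero, one_smul] at e
    calc Z σ = (Real.exp ((1 - γ) * σ) * Real.exp (-(1 - γ) * σ)) • Z σ := by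
          rw [← Real.exp_add]; ring_nf; rw [Real.exp_zero, one_smul]
      _ = Real.exp ((1 - γ) * σ) • Z 0 := by rw [← smul_smul, e]
  -- step 2: `h σ = e^{γσ} Y σ + e^{σ} Z 0` is constant
  set h : ℝ → EuclideanSpace ℝ (Fin 3) := fun σ => Real.exp (γ * σ) • Y σ + Real.exp σ • Z 0 with hh
  have hh' : ∀ σ ∈ Icc (0 : ℝ) σ₁, HasDerivAt h 0 σ := by
    intro σ hσ
    have hexp : HasDerivAt (fun r => Real.exp (γ * r)) (Real.exp (γ * σ) * γ) σ := by
      simpa using ((hasDerivAt_id σ).const_mul γ).exp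
    have h1 := (hexp.smul (hY σ hσ)).add ((Real.hasDerivAt_exp σ).smul_const (Z 0))
    refine h1.congr_deriv ?_
    rw [hZform σ hσ]
    have e1 : Real.exp (γ * σ) * Real.exp ((1 - γ) * σ) = Real.exp σ := by rw [← Real.exp_add]; ring_nf
    rw [smul_neg, smul_add, smul_smul, smul_smul, e1]
    module
  have hhc : ContinuousOn h (Icc 0 σ₁) := fun σ hσ => (hh' σ hσ).continuousAt.continuousWithinAt
  have hhconst := constant_of_has_deriv_right_zero hhc (fun σ hσ => (hh' σ (Ico_subset_Icc_self hσ)).hasDerivWithinAt)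
  intro σ hσ
  refine ⟨hZform σ hσ, ?_⟩
  have e := hhconst σ hσ
  simp only [hh, mul_zero, Real.exp_zero, one_smul] at e
  -- `Y σ = e^{−γσ} (h σ − e^{σ} Z 0)`
  have e2 : Real.exp (γ * σ) • Y σ = (Y 0 + Z 0) - Real.exp σ • Z 0 := by rw [← e]; abel
  calc Y σ = Real.exp (-γ * σ) • (Real.exp (γ * σ) • Y σ) := by
        rw [smul_smul, ← Real.exp_add]; ring_nf; rw [Real.exp_zero, one_smul]
    _ = Real.exp (-γ * σ) • (Y 0 + Z 0) - Real.exp ((1 - γ) * σ) • Z 0 := by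
        rw [e2, smul_sub, smul_smul, ← Real.exp_add]; ring_nf

/-! ### (L5) The turning law -/

/-- **(L5) TURNING LAW** (scalar calculus, exact): minimum of `a₀e^{−γσ}(1 − L₀ + L₀e^σ)` at `σ* = log(γ(1−L₀)/((1−γ)L₀))`, where
the logistic ratio equals `γ`, with the value `a₀(L₀/γ)^γ((1−L₀)/(1−γ))^{1−γ}`. [folklore] -/
theorem turningLaw {γ L₀ a₀ : ℝ} (hγ : 0 < γ) (hγ1 : γ < 1) (hL₀ : 0 < L₀) (hL₀γ : L₀ < γ) (ha₀ : 0 < a₀) :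
    IsMinOn (fun σ : ℝ => a₀ * Real.exp (-γ * σ) * (1 - L₀ + L₀ * Real.exp σ)) univ
        (Real.log (γ * (1 - L₀) / ((1 - γ) * L₀))) ∧
      L₀ * Real.exp (Real.log (γ * (1 - L₀) / ((1 - γ) * L₀))) /
          (1 - L₀ + L₀ * Real.exp (Real.log (γ * (1 - L₀) / ((1 - γ) * L₀)))) = γ ∧
      a₀ * Real.exp (-γ * Real.log (γ * (1 - L₀) / ((1 - γ) * L₀))) *
          (1 - L₀ + L₀ * Real.exp (Real.log (γ * (1 - L₀) / ((1 - γ) * L₀)))) =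
        a₀ * (L₀ / γ) ^ γ * ((1 - L₀) / (1 - γ)) ^ (1 - γ) := by
  have h1γ : 0 < 1 - γ := by linarith
  have h1L : 0 < 1 - L₀ := by linarith
  set E : ℝ := γ * (1 - L₀) / ((1 - γ) * L₀) with hE
  have hEpos : 0 < E := by rw [hE]; positivity
  have hexpE : Real.exp (Real.log E) = E := Real.exp_log hEpos
  set Q : ℝ := (1 - L₀) / (1 - γ) with hQ
  have hQpos : 0 < Q := by rw [hQ]; positivity
  have hEQ : E = (γ / L₀) * Q := by rw [hE, hQ]; field_simp
  have hden : 1 - L₀ + L₀ * E = Q := by rw [hE, hQ]; field_simp; ring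
  have hnum : L₀ * E = γ * Q := by rw [hEQ]; field_simp
  refine ⟨?_, ?_, ?_⟩
  · -- the minimum
    set f : ℝ → ℝ := fun σ => a₀ * Real.exp (-γ * σ) * (1 - L₀ + L₀ * Real.exp σ) with hf
    have hf' : ∀ σ : ℝ, HasDerivAt f (a₀ * Real.exp (-γ * σ) * ((1 - γ) * L₀ * (Real.exp σ - E))) σ := by
      intro σ
      have d1 : HasDerivAt (fun r => Real.exp (-γ * r)) (Real.exp (-γ * σ) * (-γ)) σ := by
        simpa using ((hasDerivAt_id σ).const_mul (-γ)).exp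
      have d2 : HasDerivAt (fun r => 1 - L₀ + L₀ * Real.exp r) (L₀ * Real.exp σ) σ := by
        simpa using ((Real.hasDerivAt_exp σ).const_mul L₀).const_add (1 - L₀)
      have d := (d1.const_mul a₀).mul d2
      refine d.congr_deriv ?_
      have e1 : γ * (1 - L₀) = (1 - γ) * L₀ * E := by rw [hE]; field_simp
      linear_combination (-(a₀ * Real.exp (-γ * σ))) * e1
    have hfc : Continuous f := continuous_iff_continuousAt.2 fun σ => (hf' σ).continuousAt
    have hfd : Differentiable ℝ f := fun σ => (hf' σ).differentiableAt
    have hsign : ∀ σ : ℝ, 0 < a₀ * Real.exp (-γ * σ) * ((1 - γ) * L₀) := fun σ => by positivity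
    have hanti : AntitoneOn f (Iic (Real.log E)) := by
      refine antitoneOn_of_deriv_nonpos (convex_Iic _) hfc.continuousOn (hfd.differentiableOn) fun σ hσ => ?_
      rw [interior_Iic, mem_Iio] at hσ
      rw [(hf' σ).deriv]
      have hlt : Real.exp σ < E := by rw [← hexpE]; exact Real.exp_lt_exp.2 hσ
      have := hsign σ
      nlinarith
    have hmono : MonotoneOn f (Ici (Real.log E)) := by
      refine monotoneOn_of_deriv_nonneg (convex_Ici _) hfc.continuousOn (hfd.differentiableOn) fun σ hσ => ?_
      rw [interior_Ici, mem_Ioi] at hσ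
      rw [(hf' σ).deriv]
      have hlt : E < Real.exp σ := by rw [← hexpE]; exact Real.exp_lt_exp.2 hσ
      have := hsign σ
      nlinarith
    refine isMinOn_iff.2 fun σ _ => ?_
    rcases le_or_gt σ (Real.log E) with hle | hgt
    · exact hanti (mem_Iic.2 hle) (mem_Iic.2 le_rfl) hle
    · exact hmono (mem_Ici.2 le_rfl) (mem_Ici.2 hgt.le) hgt.le
  · -- the logistic ratio at `σ*` is `γ`
    rw [hexpE, hden, hnum]
    field_simp
  · -- the value at the minimum
    rw [hexpE, hden]
    have e1 : Real.exp (-γ * Real.log E) = E ^ (-γ) := by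
      rw [Real.rpow_def_of_pos hEpos]; ring_nf
    rw [e1, hEQ, Real.mul_rpow (by positivity) hQpos.le, Real.rpow_neg (by positivity), Real.rpow_neg hQpos.le,
      Real.div_rpow hγ.le hL₀.le, Real.div_rpow hL₀.le hγ.le]
    have e2 : Q ^ (1 - γ) = Q * (Q ^ γ)⁻¹ := by
      rw [Real.rpow_sub hQpos, Real.rpow_one, div_eq_mul_inv]
    rw [e2]
    have hγγ : γ ^ γ ≠ 0 := (Real.rpow_pos_of_pos hγ γ).ne'
    have hLL : L₀ ^ γ ≠ 0 := (Real.rpow_pos_of_pos hL₀ γ).ne'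
    have hQQ : Q ^ γ ≠ 0 := (Real.rpow_pos_of_pos hQpos γ).ne'
    field_simp

/-! ### The Sketch44 texts, binder-for-binder -/

/-- **`NsregP2.R44.AngularMomentumLedger`** (Sketch44 of nsreg-p2 g34, plate t46-M; `E3` spelled out).
[cite: ConstantinIgnatovaVicol2026Putative, §3.1.1 eq. (3.3)] -/
theorem angularMomentumLedger :
    ∀ (γ : ℝ) (U : EuclideanSpace ℝ (Fin 3) → EuclideanSpace ℝ (Fin 3)) (P : EuclideanSpace ℝ (Fin 3) → ℝ),
      IsSelfSimilarEulerProfile γ 0 U P →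
      ∀ a b y : EuclideanSpace ℝ (Fin 3),
        fderiv ℝ (fun x : EuclideanSpace ℝ (Fin 3) => ⟪x, a⟫ * ⟪U x, b⟫ - ⟪x, b⟫ * ⟪U x, a⟫) y (selfSimilarTransport γ 0 U y) =
          (2 * γ - 1) * (⟪y, a⟫ * ⟪U y, b⟫ - ⟪y, b⟫ * ⟪U y, a⟫)
            - (⟪y, a⟫ * ⟪gradient P y, b⟫ - ⟪y, b⟫ * ⟪gradient P y, a⟫) :=
  fun _ _ _ hprof a b y => fderiv_angularMomentum_transport hprof a b y

/-- **`NsregP2.R44.PressureFreeOrbit`** (Sketch44, plate t46-M; `E3` spelled out). [folklore] -/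
theorem pressureFreeOrbit :
    ∀ (γ σ₁ : ℝ) (Y Z : ℝ → EuclideanSpace ℝ (Fin 3)), 0 < σ₁ →
      (∀ σ ∈ Icc (0 : ℝ) σ₁, HasDerivAt Y (-(γ • Y σ + Z σ)) σ) →
      (∀ σ ∈ Icc (0 : ℝ) σ₁, HasDerivAt Z ((1 - γ) • Z σ) σ) →
        ∀ σ ∈ Icc (0 : ℝ) σ₁,
          Z σ = Real.exp ((1 - γ) * σ) • Z 0 ∧
            Y σ = Real.exp (-γ * σ) • (Y 0 + Z 0) - Real.exp ((1 - γ) * σ) • Z 0 :=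
  fun _ _ _ _ hσ₁ hY hZ => pressureFreeOrbit_explicit hσ₁ hY hZ

/-- **`NsregP2.R44.TurningLaw`** (Sketch44, plate t46-M). [folklore] -/
theorem turningLaw_text :
    ∀ (γ L₀ a₀ : ℝ), 0 < γ → γ < 1 → 0 < L₀ → L₀ < γ → 0 < a₀ →
      IsMinOn (fun σ : ℝ => a₀ * Real.exp (-γ * σ) * (1 - L₀ + L₀ * Real.exp σ)) univ
          (Real.log (γ * (1 - L₀) / ((1 - γ) * L₀))) ∧
        L₀ * Real.exp (Real.log (γ * (1 - L₀) / ((1 - γ) * L₀))) /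
            (1 - L₀ + L₀ * Real.exp (Real.log (γ * (1 - L₀) / ((1 - γ) * L₀)))) = γ ∧
        a₀ * Real.exp (-γ * Real.log (γ * (1 - L₀) / ((1 - γ) * L₀))) *
            (1 - L₀ + L₀ * Real.exp (Real.log (γ * (1 - L₀) / ((1 - γ) * L₀)))) =
          a₀ * (L₀ / γ) ^ γ * ((1 - L₀) / (1 - γ)) ^ (1 - γ) :=
  fun _ _ _ hγ hγ1 hL₀ hL₀γ ha₀ => turningLaw hγ hγ1 hL₀ hL₀γ ha₀

end Summit.NavierStokesRegularity.NavierStokesRegularity.Theorems.PowerGaugeEulerLiouville.Logistic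

end
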